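import Mathlib
import Literature.Analysis.FluidPDE.RieszPressureL3
import Literature.Analysis.FluidPDE.RieszPressureLocality
import Literature.Analysis.FluidPDE.NormalisedPressureLpClass
import Literature.Analysis.FluidPDE.TaoEnergyLocalisationPressure
import Literature.Analysis.FluidPDE.LeraySchemePressureLp
import HarnessLib

/-!
# Rung C1 of the crux `EulerZoomLiouville.PowerGaugeEulerLiouville` at the endpoint `ρ = 1/2`:
# Riesz-pressure tools for the shell estimates (Chae–Shvydkoy 2013, proof of Thm 3.1)

Route №10 `EulerZoomLiouville` (NavierStokesRegularity), crux E = stmt-NavierStokesRegularity-19832,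
tenure rung C1 at the endpoint.  Chae–Shvydkoy's proof of Thm 3.1 (arXiv:1201.6009, §3.1) splits
the associated pressure of the profile on a dyadic shell `|y| ~ L` into the near sources
`|z| < L/8`, the mid sources `|z| ~ L` and the far sources `|z| ≥ 32L`: the near and far parts are
honest kernel integrals of size `‖V‖₂²/L³` on the shell, the mid part is controlled in `L²` by the
Calderón–Zygmund theorem.  This file provides these pieces in the tree's vocabulary
(`rieszPressure` = the whole-space pressure `Π[w] = −Δ⁻¹∂ᵢ∂ⱼ(wᵢwⱼ)` of an `L³` field,
`normalisedPressure`, `pressureKernel`):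

* `normalisedPressure_ae_eq_rieszPressure` — on `L³` the pointwise principal-value pressure and
  the `L³ → L^{3/2}` Riesz pressure agree a.e. (both solve the weak Poisson equation in `L^{3/2}`);
* `exists_eLpNorm_rieszPressure_two_le` — Stein's `L²` bound `‖Π[w]‖₂ ≤ C ‖w‖₄²` on `L³ ∩ L⁴`;
* `abs_integral_pressureKernel_near_le`, `abs_setIntegral_pressureKernel_far_le` — the kernel
  bounds `|∫_{|z|<r} K(y−z)(V z) dz| ≤ ‖V‖₂²/(2π r³)` for `|y| ≥ 2r` and
  `|∫_{|z|≥R} K(y−z)(V z) dz| ≤ 8‖V‖₂²/(2π R³)` for `|y| ≤ R/2`;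
* `rieszPressure_indicator_ball_ae_eq_integral` — the far-field REPRESENTATION of the near part:
  for a.e. `y` with `|y| ≥ 2r`, `Π[V·1_{B_r}](y) = ∫ K(y−z)(V·1_{B_r})(z) dz` (countable cover of
  the exterior by the balls of the tree's `rieszPressure_ae_eq_integral_pressureKernel`).

WHAT THIS IS NOT: not NS, not E, not rung C1 — harmonic-analysis plumbing for one stratum.
-/

noncomputable section

-- flat `Theorems/<Route><Decl>…` files of one crux share the namespace of the crux (tree convention)
set_option linter.dupNamespace false

open MeasureTheory Set Filter Topology Metric Function
open scoped ENNReal NNReal InnerProductSpace RealInnerProductSpace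

namespace Summit.NavierStokesRegularity.NavierStokesRegularity.Theorems.PowerGaugeEulerLiouville

open Literature.Analysis Literature.Analysis.FluidPDE

section Bridge

/-- **On `L³` the principal-value pressure is the Riesz pressure a.e.**  For `w ∈ L³(ℝ³)` the
pointwise normalised pressure `p̃[w]` (principal value, a.e. defined) lies in `L^{3/2}` and solves
the weak Poisson equation `∫ p̃[w] Δφ = −∫ D²φ(w,w)`; so does `Π[w]`; uniqueness in `L^{3/2}`.
[cite: Stein1971, Ch. II §4.2 Thm 3 and Ch. III §1] -/
theorem normalisedPressure_ae_eq_rieszPressure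
    {w : EuclideanSpace ℝ (Fin 3) → EuclideanSpace ℝ (Fin 3)} (hw : MemLp w 3 volume) :
    normalisedPressure w =ᵐ[volume] rieszPressure w := by
  have h1 : (1 : ℝ≥0∞) < 3 / 2 :=
    (ENNReal.lt_div_iff_mul_lt (Or.inl (by norm_num)) (Or.inl (by norm_num))).2 (by norm_num)
  have h2 : (3 / 2 : ℝ≥0∞) < ⊤ := ENNReal.div_lt_top ENNReal.ofNat_ne_top two_ne_zero
  have hw' : MemLp w (2 * (3 / 2)) volume := by rwa [two_mul_threeHalves_ennreal]
  refine ae_eq_rieszPressure_of_forall_integral_mul_laplacian hw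
    (memLp_normalisedPressure_of_memLp_two_mul h1 h2 hw') fun φ hφ hφc => ?_
  exact integral_normalisedPressure_mul_laplacian_of_memLp h1 h2 hw' hφ hφc

/-- **Stein's `L²` bound for the Riesz pressure on `L³ ∩ L⁴`:** there is an absolute `C` with
`‖Π[w]‖_{L²} ≤ C ‖w‖²_{L⁴}` for every `w ∈ L³ ∩ L⁴` (the Calderón–Zygmund theorem for
`−ℛᵢℛⱼ` at exponent `2`, the tree's `exists_eLpNorm_normalisedPressure_le_sq`, transported
through `normalisedPressure_ae_eq_rieszPressure`). [cite: Stein1971, Ch. II §4.2 Thm 3 (b)] -/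
theorem exists_eLpNorm_rieszPressure_two_le :
    ∃ C : ℝ≥0, ∀ w : EuclideanSpace ℝ (Fin 3) → EuclideanSpace ℝ (Fin 3), MemLp w 3 volume →
      MemLp w 4 volume → eLpNorm (rieszPressure w) 2 volume ≤ C * eLpNorm w 4 volume ^ 2 := by
  obtain ⟨C, hC⟩ := exists_eLpNorm_normalisedPressure_le_sq (p := 2) (by norm_num) (by norm_num)
  refine ⟨C, fun w hw3 hw4 => ?_⟩
  have h4 : (2 : ℝ≥0∞) * 2 = 4 := by norm_num
  rw [← eLpNorm_congr_ae (normalisedPressure_ae_eq_rieszPressure hw3), ← h4]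
  exact hC w (by rwa [h4])

end Bridge

section Kernel

/-- Pointwise kernel bound against an `L²` density away from the evaluation point: if
`‖y − z‖ ≥ d > 0` wherever `U z ≠ 0`, then `|K(y−z)(U z)| ≤ ‖U z‖²/(2π d³)`. [folklore] -/
theorem abs_pressureKernel_apply_le_of_dist {U : EuclideanSpace ℝ (Fin 3) → EuclideanSpace ℝ (Fin 3)}
    {y z : EuclideanSpace ℝ (Fin 3)} {d : ℝ} (hd : 0 < d) (hz : U z ≠ 0 → d ≤ ‖y - z‖) :
    |pressureKernel (y - z) (U z)| ≤ ‖U z‖ ^ 2 / (2 * Real.pi * d ^ 3) := by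
  by_cases hU : U z = 0
  · rw [hU, pressureKernel_zero_right, abs_zero, norm_zero]; positivity
  have hdz := hz hU
  have hyz : 0 < ‖y - z‖ := hd.trans_le hdz
  calc |pressureKernel (y - z) (U z)| ≤ ‖U z‖ ^ 2 / (2 * Real.pi * ‖y - z‖ ^ 3) :=
        abs_pressureKernel_le _ _
    _ ≤ ‖U z‖ ^ 2 / (2 * Real.pi * d ^ 3) := by
        gcongr

/-- **Near sources seen from the shell.**  For `r > 0`, `V` with `∫ ‖V‖² < ∞` and `|y| ≥ 2r`:
`|∫ K(y−z)(V·1_{B_r})(z) dz| ≤ (∫ ‖V‖²)/(2π r³)` (`‖y − z‖ ≥ r` on the sources).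
[cite: ChaeShvydkoy2013, §3.1 proof of Thm. 3.1 (the term q₁)] -/
theorem abs_integral_pressureKernel_near_le
    {V : EuclideanSpace ℝ (Fin 3) → EuclideanSpace ℝ (Fin 3)}
    (hV2 : Integrable (fun z => ‖V z‖ ^ 2) volume) {r : ℝ} (hr : 0 < r)
    {y : EuclideanSpace ℝ (Fin 3)} (hy : 2 * r ≤ ‖y‖) :
    |∫ z, pressureKernel (y - z) ((ball (0 : EuclideanSpace ℝ (Fin 3)) r).indicator V z)| ≤
      (∫ z, ‖V z‖ ^ 2) / (2 * Real.pi * r ^ 3) := by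
  set U := (ball (0 : EuclideanSpace ℝ (Fin 3)) r).indicator V with hU
  have hpt : ∀ z, |pressureKernel (y - z) (U z)| ≤ ‖V z‖ ^ 2 / (2 * Real.pi * r ^ 3) := by
    intro z
    refine (abs_pressureKernel_apply_le_of_dist hr fun hz => ?_).trans ?_
    · have hzr : z ∈ ball (0 : EuclideanSpace ℝ (Fin 3)) r := by
        by_contra h; exact hz (by rw [hU, indicator_of_notMem h])
      rw [mem_ball, dist_zero_right] at hzr
      have h2 : ‖y‖ - ‖z‖ ≤ ‖y - z‖ := norm_sub_norm_le y z
      linarith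
    · gcongr
      rw [hU]
      exact norm_indicator_le_norm_self _ _
  calc |∫ z, pressureKernel (y - z) (U z)| = ‖∫ z, pressureKernel (y - z) (U z)‖ := (Real.norm_eq_abs _).symm
    _ ≤ ∫ z, ‖V z‖ ^ 2 / (2 * Real.pi * r ^ 3) :=
        norm_integral_le_of_norm_le (hV2.div_const _) (Eventually.of_forall fun z => by
          rw [Real.norm_eq_abs]; exact hpt z)
    _ = (∫ z, ‖V z‖ ^ 2) / (2 * Real.pi * r ^ 3) := integral_div _ _

/-- **Far sources seen from the shell.**  For `R > 0`, `V` with `∫ ‖V‖² < ∞` and `|y| ≤ R/2`: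
`|∫_{|z| ≥ R} K(y−z)(V z) dz| ≤ 8 (∫ ‖V‖²)/(2π R³)` (`‖y − z‖ ≥ R/2` on the sources).
[cite: ChaeShvydkoy2013, §3.1 proof of Thm. 3.1 (the term q₃)] -/
theorem abs_setIntegral_pressureKernel_far_le
    {V : EuclideanSpace ℝ (Fin 3) → EuclideanSpace ℝ (Fin 3)}
    (hV2 : Integrable (fun z => ‖V z‖ ^ 2) volume) {R : ℝ} (hR : 0 < R)
    {y : EuclideanSpace ℝ (Fin 3)} (hy : ‖y‖ ≤ R / 2) :
    |∫ z in {z | R ≤ ‖z‖}, pressureKernel (y - z) (V z)| ≤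
      8 * (∫ z, ‖V z‖ ^ 2) / (2 * Real.pi * R ^ 3) := by
  have hSm : MeasurableSet {z : EuclideanSpace ℝ (Fin 3) | R ≤ ‖z‖} :=
    measurableSet_le measurable_const measurable_norm
  rw [← integral_indicator hSm]
  set U := ({z : EuclideanSpace ℝ (Fin 3) | R ≤ ‖z‖}).indicator V with hU
  have hind : ∀ z, ({z : EuclideanSpace ℝ (Fin 3) | R ≤ ‖z‖}).indicator
      (fun z => pressureKernel (y - z) (V z)) z = pressureKernel (y - z) (U z) := by
    intro z
    by_cases hz : z ∈ {z : EuclideanSpace ℝ (Fin 3) | R ≤ ‖z‖}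
    · rw [indicator_of_mem hz, hU, indicator_of_mem hz]
    · rw [indicator_of_notMem hz, hU, indicator_of_notMem hz, pressureKernel_zero_right]
  simp_rw [hind]
  have hR2 : 0 < R / 2 := by positivity
  have hpt : ∀ z, |pressureKernel (y - z) (U z)| ≤ ‖V z‖ ^ 2 / (2 * Real.pi * (R / 2) ^ 3) := by
    intro z
    refine (abs_pressureKernel_apply_le_of_dist hR2 fun hz => ?_).trans ?_
    · have hzR : z ∈ {z : EuclideanSpace ℝ (Fin 3) | R ≤ ‖z‖} := by
        by_contra h; exact hz (by rw [hU, indicator_of_notMem h])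
      simp only [mem_setOf_eq] at hzR
      have h2 : ‖z‖ - ‖y‖ ≤ ‖y - z‖ := by
        rw [norm_sub_rev]; exact norm_sub_norm_le z y
      linarith
    · gcongr
      rw [hU]
      exact norm_indicator_le_norm_self _ _
  calc |∫ z, pressureKernel (y - z) (U z)| = ‖∫ z, pressureKernel (y - z) (U z)‖ :=
        (Real.norm_eq_abs _).symm
    _ ≤ ∫ z, ‖V z‖ ^ 2 / (2 * Real.pi * (R / 2) ^ 3) :=
        norm_integral_le_of_norm_le (hV2.div_const _) (Eventually.of_forall fun z => by
          rw [Real.norm_eq_abs]; exact hpt z)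
    _ = (∫ z, ‖V z‖ ^ 2) / (2 * Real.pi * (R / 2) ^ 3) := integral_div _ _
    _ = 8 * (∫ z, ‖V z‖ ^ 2) / (2 * Real.pi * R ^ 3) := by
        field_simp
        ring

end Kernel

section Representation

/-- **Far-field representation of the near part on the shell.**  Let `r > 0` and
`V·1_{B_r} ∈ L³`.  Then for a.e. `y` with `|y| ≥ 2r` the Riesz pressure of the near sources is
the honest kernel integral: `Π[V·1_{B_r}](y) = ∫ K(y−z)(V·1_{B_r})(z) dz` (the tree's
`rieszPressure_ae_eq_integral_pressureKernel` on each ball `B(a, r/4)` of a countable cover of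
`{|y| ≥ 2r}` by balls centred at a dense sequence with `|a| ≥ 3r/2`).
[cite: RobinsonRodrigoSadowski2016, proof of Lemma 15.12 p. 232] -/
theorem rieszPressure_indicator_ball_ae_eq_integral
    {V : EuclideanSpace ℝ (Fin 3) → EuclideanSpace ℝ (Fin 3)} {r : ℝ} (hr : 0 < r)
    (hV3 : MemLp ((ball (0 : EuclideanSpace ℝ (Fin 3)) r).indicator V) 3 volume) :
    ∀ᵐ y : EuclideanSpace ℝ (Fin 3), 2 * r ≤ ‖y‖ →
      rieszPressure ((ball (0 : EuclideanSpace ℝ (Fin 3)) r).indicator V) y =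
        ∫ z, pressureKernel (y - z) ((ball (0 : EuclideanSpace ℝ (Fin 3)) r).indicator V z) := by
  set U := (ball (0 : EuclideanSpace ℝ (Fin 3)) r).indicator V with hU
  obtain ⟨d, hd⟩ := TopologicalSpace.exists_dense_seq (EuclideanSpace ℝ (Fin 3))
  -- on each ball `B(d n, r/4)` with `|d n| ≥ 3r/2`
  have hball : ∀ n : ℕ, ∀ᵐ y : EuclideanSpace ℝ (Fin 3), y ∈ ball (d n) (r / 4) →
      3 * r / 2 ≤ ‖d n‖ → rieszPressure U y = ∫ z, pressureKernel (y - z) (U z) := by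
    intro n
    by_cases hn : 3 * r / 2 ≤ ‖d n‖
    · have hvan : ∀ z ∈ ball (d n) (r / 2), U z = 0 := by
        intro z hz
        rw [hU, indicator_of_notMem]
        rw [mem_ball, dist_zero_right, not_lt]
        rw [mem_ball, dist_eq_norm] at hz
        have h' : ‖d n‖ - ‖z‖ ≤ ‖z - d n‖ := by rw [norm_sub_rev]; exact norm_sub_norm_le _ _
        linarith
      have hout : ∀ z ∉ closedBall (d n) (‖d n‖ + r), U z = 0 := by
        intro z hz
        rw [hU, indicator_of_notMem]
        rw [mem_closedBall, dist_eq_norm, not_le] at hz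
        rw [mem_ball, dist_zero_right, not_lt]
        have := norm_sub_le z (d n)
        have h' : ‖z - d n‖ ≤ ‖z‖ + ‖d n‖ := norm_sub_le _ _
        linarith
      have h := rieszPressure_ae_eq_integral_pressureKernel (a := d n) hV3
        (by positivity : 0 < r / 4) (by linarith : r / 4 < r / 2) hvan hout
      rw [ae_restrict_iff' measurableSet_ball] at h
      filter_upwards [h] with y hy hyb _
      exact hy hyb
    · exact Eventually.of_forall fun y _ h => absurd h hn
  rw [← ae_all_iff] at hball
  filter_upwards [hball] with y hy hyr
  -- pick `n` with `dist y (d n) < r/4`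
  obtain ⟨n, hn⟩ : ∃ n, dist y (d n) < r / 4 := by
    have := Metric.denseRange_iff.1 hd y (r / 4) (by positivity)
    simpa [dist_comm] using this
  have hdn : 3 * r / 2 ≤ ‖d n‖ := by
    rw [dist_eq_norm] at hn
    have h' : ‖y‖ - ‖d n‖ ≤ ‖y - d n‖ := norm_sub_norm_le _ _
    linarith
  exact hy n (by rwa [mem_ball]) hdn

end Representation

end Summit.NavierStokesRegularity.NavierStokesRegularity.Theorems.PowerGaugeEulerLiouville
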